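/-
Origin: expansion seat `literature-prover-pub-hodgecm-cf-hasseminkowski-g5-0`, handover #3 2026-08-18T06:12:45Z (`HOME/pub-hodgecm-cf-hasseminkowski-g5/handover/HodgeCM/Literature/ClassBaseChangePolar.lean`, md5 c295cf30, 151 lines);
landed by the gen-6 packager in gate run 24 as `HodgeCM/Literature/ClassBaseChangePolar.lean` (verbatim).
-/
/-
Origin: CITED-FACT seat (4), unit `pub-hodgecm-cf-hasseminkowski-g5` (session literature-prover-pub-hodgecm-cf-hasseminkowski-g5-0),
HodgeCM publication cell, 2026-08-18.  Intended landing: `HodgeCM/Literature/ClassBaseChangePolar.lean` (after `ClassBaseChange.lean`).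
-/
import Summits.HodgeConjecture.HodgeCM.Literature.ClassBaseChange
import Summits.HodgeConjecture.HodgeCM.PerL34.N15Existence
import Mathlib.NumberTheory.NumberField.CMField

/-!
# `hpolar` for the actual base change, and N15 over `C_{L₀} → C_L`

PerL v5 §3.2, tex ll. 306–313 (node N15).  pv10's capstone
`N15Existence.exists_unitaryHeckeCharacter_of_isProperMap (f : A →* C_L) (hf : IsProperMap f) (χA) (hχA) (hker) (e)
(hcompat) (hpolar)` abstracts "the image of the idele class group of `L₀`" as a proper homomorphism `f`.
With `ClassBaseChange.lean` the map is the ACTUAL base change `classBaseChange L₀ L` and `hf` is the theorem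
`isProperMap_classBaseChange`.  This file discharges the remaining STRUCTURAL hypothesis `hpolar` ("every infinite
idele class is an `L₀`-class times a norm-one class" — PerL l. 312: `z = |z|·(z/|z|)` with `|z| ∈ ℝ_{>0} ⊂ L^×_{0,v}`)
for that map, whenever every infinite place of `L₀` has exactly ONE place of `L` above it — in particular for a CM
extension `L/L⁺` (Mathlib `IsCMField.equivInfinitePlace`):

* `ClassBaseChange.exists_ideleBaseChange_eq_of_mem_posRealUnits`: under injectivity of `w ↦ w|_{L₀}` on infinite
  places, a positive-real infinite idele `(r_w)_w` of `L` is the base change of the infinite idele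
  `(r_{w(v)})_v` of `L₀` (`K_v → L_w` fixes the canonical `ℝ`, `ClassBaseChange.infiniteCompletionOfComap_realToCompletion`);
* `hpolar_classBaseChange`, `hpolar_classBaseChange_of_isCMField`: pv10's `hpolar` for `f = classBaseChange L₀ L`
  (via pv10 `PolarDecomposition.hpolar_of_posRealUnits_le`);
* **`exists_unitaryHeckeCharacter_of_classBaseChange`** (+ `_of_isCMField`): N15 with `f = classBaseChange L₀ L`,
  `hf`, `hpolar` ALL supplied — what remains are PerL's own character data: `χA` (= `ε^m_{L/L₀}` as a continuous
  character of `C_{L₀}`) with `hker`, the infinity type `e = (m_b)_b`, and the parity compatibility `hcompat`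
  ("`m_b ≡ m (mod 2)`", tex l. 307) — instantiation data of the D3 dictionary, not inferences.

No PerL/QW8/2001 statement is used; no named fact is introduced; everything below is proved.
-/

set_option autoImplicit false

noncomputable section

open NumberField InfinitePlace NumberField.InfinitePlace.Completion

namespace NumberField

open Literature.NumberTheory Literature.NumberTheory.Automorphic

variable (K L : Type) [Field K] [NumberField K] [Field L] [NumberField L] [Algebra K L]

namespace ClassBaseChange

/-- A positive-real infinite idele of `L` is a base change from `K`, provided every infinite place of `K` has
a unique place of `L` above it. -/
theorem exists_ideleBaseChange_eq_of_mem_posRealUnits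
    (hinj : Function.Injective fun w : InfinitePlace L => w.comap (algebraMap K L))
    {p : (InfiniteAdeleRing L)ˣ} (hp : p ∈ InfiniteAdeleRing.posRealUnits L) :
    ∃ u : (InfiniteAdeleRing K)ˣ,
      AdeleRing.ideleBaseChange K L (infUnitsToIdele K u) = infUnitsToIdele L p := by
  classical
  choose r hr0 hr using hp
  have hsurj : Function.Surjective fun w : InfinitePlace L => w.comap (algebraMap K L) :=
    comap_surjective
  have hσ1 : ∀ v, (Function.surjInv hsurj v).comap (algebraMap K L) = v := Function.surjInv_eq hsurj
  have hσ2 : ∀ w, Function.surjInv hsurj (w.comap (algebraMap K L)) = w := fun w => hinj (hσ1 _)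
  -- the positive real components of `p`, read in `K_v`
  let u : (InfiniteAdeleRing K)ˣ :=
    ⟨fun v => realToCompletion K v (r (Function.surjInv hsurj v)),
     fun v => realToCompletion K v (r (Function.surjInv hsurj v))⁻¹,
     funext fun v => show realToCompletion K v _ * realToCompletion K v _ = 1 by
       rw [← map_mul, mul_inv_cancel₀ (hr0 _).ne', map_one],
     funext fun v => show realToCompletion K v _ * realToCompletion K v _ = 1 by
       rw [← map_mul, inv_mul_cancel₀ (hr0 _).ne', map_one]⟩
  refine ⟨u, Units.ext ?_⟩
  rw [AdeleRing.coe_ideleBaseChange, coe_infUnitsToIdele, coe_infUnitsToIdele]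
  refine Prod.ext ?_ ?_
  · rw [AdeleRing.baseChange_fst]
    funext w
    rw [InfiniteAdeleRing.baseChange_apply]
    show infiniteCompletionOfComap K L w
        (realToCompletion K (w.comap (algebraMap K L)) (r (Function.surjInv hsurj (w.comap (algebraMap K L))))) =
      (p : InfiniteAdeleRing L) w
    rw [hσ2, infiniteCompletionOfComap_realToCompletion]
    exact (extensionEmbedding w).injective (by rw [extensionEmbedding_realToCompletion, hr])
  · rw [AdeleRing.baseChange_snd, map_one]

/-- The positive-real idele classes of `L` are base changes (hypothesis `hpos` of pv10's
`hpolar_of_posRealUnits_le`, for `f = classBaseChange K L`). -/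
theorem posRealToClass_range_le
    (hinj : Function.Injective fun w : InfinitePlace L => w.comap (algebraMap K L)) :
    (posRealToClass L).range ≤ (classBaseChange K L).range := by
  rintro _ ⟨p, rfl⟩
  obtain ⟨u, hu⟩ := exists_ideleBaseChange_eq_of_mem_posRealUnits K L hinj p.2
  refine ⟨infUnitsToClass K u, ?_⟩
  rw [posRealToClass_apply]
  show classBaseChange K L (QuotientGroup.mk (infUnitsToIdele K u)) = QuotientGroup.mk (infUnitsToIdele L p)
  rw [classBaseChange_mk, hu]

end ClassBaseChange

/-- **`hpolar` for the base change** (PerL l. 312): if every infinite place of `K` has a unique place of `L`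
above it, every infinite idele class of `L` is a base-changed class times a norm-one class. -/
theorem hpolar_classBaseChange
    (hinj : Function.Injective fun w : InfinitePlace L => w.comap (algebraMap K L)) :
    (infUnitsToClass L).range ≤ (classBaseChange K L).range ⊔ (torusToClass L).range :=
  hpolar_of_posRealUnits_le L (classBaseChange K L) (ClassBaseChange.posRealToClass_range_le K L hinj)

/-- **N15 over the actual base change `C_K → C_L`.**  For an extension `L/K` of number fields in which every
infinite place of `K` has a unique place above it, a continuous character `χA` of `C_K` killing the kernel of
the base change, and an infinity type `e` compatible with `χA` on base-changed infinite classes, there is a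
unitary Hecke character `ψ` of `L` of infinity type `e` with `ψ ∘ ι = χA` (PerL v5 ll. 305–313: proper image
(`isProperMap_classBaseChange`), `hpolar` (`hpolar_classBaseChange`), gluing + extension (pv10's capstone)). -/
theorem exists_unitaryHeckeCharacter_of_classBaseChange
    (hinj : Function.Injective fun w : InfinitePlace L => w.comap (algebraMap K L))
    (χA : IdeleClassGroup K →* Circle) (hχA : Continuous χA)
    (hker : ∀ a, classBaseChange K L a = 1 → χA a = 1) (e : InfinitePlace L → ℤ)
    (hcompat : ∀ (a : IdeleClassGroup K) (u : (InfiniteAdeleRing L)ˣ),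
      classBaseChange K L a = infUnitsToClass L u → χA a = infinityTypeChar L e u) :
    ∃ ψ : UnitaryHeckeCharacter L, ψ.HasInfinityType L e ∧ ∀ a, ψ (classBaseChange K L a) = χA a :=
  exists_unitaryHeckeCharacter_of_isProperMap L (classBaseChange K L) (isProperMap_classBaseChange K L)
    χA hχA hker e hcompat (hpolar_classBaseChange K L hinj)

/-! ### The CM case `L/L⁺` (Mathlib `IsCMField`) -/

section CM

variable (L : Type) [Field L] [NumberField L] [IsCMField L]

/-- For a CM field, restriction of infinite places `L → L⁺` is injective (Mathlib `IsCMField.equivInfinitePlace`). -/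
theorem comap_injective_of_isCMField :
    Function.Injective fun w : InfinitePlace L => w.comap (algebraMap (maximalRealSubfield L) L) :=
  (IsCMField.equivInfinitePlace L).injective

/-- `hpolar` for the CM base change `C_{L⁺} → C_L`. -/
theorem hpolar_classBaseChange_of_isCMField :
    (infUnitsToClass L).range ≤
      (classBaseChange (maximalRealSubfield L) L).range ⊔ (torusToClass L).range :=
  hpolar_classBaseChange (maximalRealSubfield L) L (comap_injective_of_isCMField L)

/-- **N15 for a CM field over its maximal real subfield** (PerL's `L/L₀`): all structural hypotheses of pv10's
capstone supplied; the inputs are the character data `χA`, `hker`, `e`, `hcompat` only. -/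
theorem exists_unitaryHeckeCharacter_of_isCMField
    (χA : IdeleClassGroup (maximalRealSubfield L) →* Circle) (hχA : Continuous χA)
    (hker : ∀ a, classBaseChange (maximalRealSubfield L) L a = 1 → χA a = 1) (e : InfinitePlace L → ℤ)
    (hcompat : ∀ (a : IdeleClassGroup (maximalRealSubfield L)) (u : (InfiniteAdeleRing L)ˣ),
      classBaseChange (maximalRealSubfield L) L a = infUnitsToClass L u → χA a = infinityTypeChar L e u) :
    ∃ ψ : UnitaryHeckeCharacter L, ψ.HasInfinityType L e ∧
      ∀ a, ψ (classBaseChange (maximalRealSubfield L) L a) = χA a :=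
  exists_unitaryHeckeCharacter_of_classBaseChange (maximalRealSubfield L) L (comap_injective_of_isCMField L)
    χA hχA hker e hcompat

end CM

end NumberField

end
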